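import Mathlib
import Summits.NavierStokesRegularity.FluidComputer.TransportGalerkinResidenceBox
import Summits.NavierStokesRegularity.FluidComputer.TransportGalerkinShift
import Summits.NavierStokesRegularity.FluidComputer.TransportGalerkinEigen
import HarnessLib

/-!
# Galerkin limit of the transport model, XI: KEEP with RESIDENCE REPLACED BY THE BOOTSTRAP'S `H²` BOUND (instab g19, cell `ns-blowup`, 2026-08-27)

HONEST FRAMING (human ruling D-0035): nothing here is a claim about Navier–Stokes blow-up.
WHAT THIS IS NOT: not NS — a MODEL theorem schema (perturbation equation about a smooth host on
`𝕋^d` in the scaled phase space `E = lp (ℤ^d → V) 2`), whose load-bearing inputs are the Lyapunov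
certificates of record and two properties of the Galerkin ODE levels. No number or census word moves.

PURPOSE. `TransportGalerkinShift.half_prediction_nsField_shift` (g18) reads the R-β KEEP word for the
true model trajectory from: host + RADII `ρ` of a polynomial box `W` + RESIDENCE of all Galerkin
levels in `W` (`sol_mem`, β3 — priced in `HOME/instab/BETA2-SPEC.md` §6 as computer-assisted
integration) + certificates + eigen/seed data + `w ∈ W`. THIS FILE (`half_prediction_nsField_of_levelBound`)
removes `ρ`, `W`, `Z`, `sol_mem`, `ε•v ∈ Z` and `w t ∈ W` from the hypotheses. What replaces them:

* `ν > 0` (strict: dissipation absorbs the derivative loss of the self-advection);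
* the Galerkin levels `u n` of the ONE seed `ε•v` exist on `[0, T]` as solutions of the
  finite-dimensional ODE `y' = P_{n+K} F(y)` in `range P_{n+K}` keeping the three LINEAR clauses
  (Leray-fixed, real, divergence-free — linear invariants of the Galerkin ODE), and obey ONE bound
  `‖u n t‖ ≤ r` in `E` (`= H²`) on the window — the bound the KEEP bootstrap itself propagates at every
  level (`‖u n t‖ ≤ (3/2) ε e^{λt} ≤ (3/2) ε e^{λT}`);
* the seed `v` is rapidly decreasing with the three clauses (for the ABC model: the OUTPUT of the X0
  door `TransportGalerkinAbcEigen.exists_eigenData_of_isLinNSEigenvalue_abc`);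
* the true solution `w` is read in the class of trajectories with a uniform polynomial tail of scaled
  order `d + 3` (every solution whose unscaled coefficients stay bounded in `H^{d+5}` qualifies; the
  Galerkin limit of `GalerkinConvergenceSetting.exists_limit` does).

Mechanism: `TransportGalerkinResidenceBox.exists_residence_box` manufactures ONE summable box with a
floor from the `H²` bound (parts IV–X: order-`σ` commutators, the energy inequality, absorption at
order three, Gronwall), the seed and `w` fit under the floor, and g18's theorem applies verbatim.
KERNEL STATE: between the certificates and the KEEP word stand (i) global existence + linear
invariants of the finite-dimensional Galerkin ODE, (ii) the level-uniform `H²` bound — which is the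
bootstrap's own conclusion on the window. No computer-assisted integration.
-/

noncomputable section

open scoped ENNReal NNReal ComplexConjugate InnerProductSpace
open Set Filter Topology

namespace Summit.NavierStokesRegularity.FluidComputer.TransportGalerkinEmergenceH2

open RCLike
open Literature.Analysis.FunctionSpaces Literature.Analysis.FunctionSpaces.Lattice
open Literature.Analysis.FunctionSpaces.Torus
open Literature.Analysis.ODE
open Summit.NavierStokesRegularity.FluidComputer.GalerkinLatticePhaseSpace
open Summit.NavierStokesRegularity.FluidComputer.TransportGalerkin
open Summit.NavierStokesRegularity.FluidComputer.TransportGalerkinRapid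
open Summit.NavierStokesRegularity.FluidComputer.TransportGalerkinBox
open Summit.NavierStokesRegularity.FluidComputer.TransportGalerkinEigen
open Summit.NavierStokesRegularity.FluidComputer.TransportGalerkinResidencePrep
open Summit.NavierStokesRegularity.FluidComputer.TransportGalerkinResidenceBox
open Summit.NavierStokesRegularity.FluidComputer.TransportGalerkinShift

variable {d : Type*} [Fintype d] [DecidableEq d]
variable {V : Type*} [NormedAddCommGroup V] [InnerProductSpace ℂ V] [CompleteSpace V] [ProperSpace V]
variable {ν : ℝ} {Uv : (d → ℤ) → V} {π : d → (V →L[ℂ] ℂ)} {P : (d → ℤ) → (V →L[ℂ] V)}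

/-! ## §1 Small bookkeeping: truncation and energies, seeds in boxes -/

section Prep

omit [DecidableEq d] [CompleteSpace V] [ProperSpace V] in
/-- Real multiples: `⇑(ε • x)` is rapidly decreasing with `⇑x`. -/
theorem rapidDecay_coe_smul {x : lp (fun _ : (d → ℤ) => V) 2} (hx : RapidDecay (⇑x)) (ε : ℝ) :
    RapidDecay (⇑(ε • x)) := by
  have h : (⇑(ε • x) : (d → ℤ) → V) = (ε : ℂ) • ⇑x := by
    funext k; rw [coe_real_smul_apply, Pi.smul_apply]
  rw [h]; exact hx.const_smul _

omit [CompleteSpace V] [ProperSpace V] in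
/-- **Truncation does not increase any unscaled energy**:
`‖Λ⁻² ⇑(P_m z)‖_s² ≤ ‖Λ⁻² ⇑z‖_s²`. -/
theorem eNormSq_unscale_cubeProj_le (s : ℝ) (m : ℕ) (z : lp (fun _ : (d → ℤ) => V) 2) :
    eNormSq s (wmul (-2) ⇑(cubeProj m z)) ≤ eNormSq s (wmul (-2) ⇑z) :=
  eNormSq_le_of_norm_le_norm fun k => by
    rw [norm_wmul_apply, norm_wmul_apply]
    exact mul_le_mul_of_nonneg_left (norm_cubeProj_apply_le m z k) (sobolevWeight_pos _ _).le

omit [Fintype d] [DecidableEq d] [InnerProductSpace ℂ V] [CompleteSpace V] [ProperSpace V] in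
/-- A coordinate of an `ℓ²` element is bounded by its norm. -/
theorem norm_apply_le (x : lp (fun _ : (d → ℤ) => V) 2) (k : d → ℤ) : ‖x k‖ ≤ ‖x‖ :=
  lp.norm_apply_le_norm (by norm_num) x k

end Prep

/-! ## §2 KEEP from the certificates, level existence and the bootstrap's `H²` bound -/

section Keep

/-- **KEEP for the model WITHOUT a residence hypothesis** (`half_prediction_nsField_of_levelBound`).
Compared with `TransportGalerkinShift.half_prediction_nsField_shift` the inputs `ρ`/`W`/`Z`,
`sol_mem`, `ε•v ∈ Z` and `w t ∈ W` are GONE; in their place: `ν > 0`, the lattice constant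
`σ₂² = ∑⟨l⟩⁻⁴ < ∞` (true for `card d ≤ 3`), the level solutions `u n` of the one seed `ε•v` as
solutions of the Galerkin ODE on `[0, T]` in `range P_{n+K}` keeping the three linear clauses and ONE
`E`-norm bound `r` (the bootstrap's own `(3/2)εe^{λT}` qualifies), a rapidly decreasing constrained
seed `v`, and a true solution `w` with a uniform polynomial tail of scaled order `d + 3` and the
clauses. Everything else (certificate objects and inequalities at levels `≥ K`, eigen data, margin,
window) is verbatim g18's list. -/
theorem half_prediction_nsField_of_levelBound (K : ℕ) (hν : 0 < ν) (hUv : RapidDecay Uv)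
    (hUreal : ∀ j p, π j (Uv (-p)) = conj (π j (Uv p)))
    (hUdiv : ∑ j, freqDeriv j (fun p => π j (Uv p)) = 0) (hπ : ∀ j, ‖π j‖ ≤ 1)
    (hPsa : ∀ k, IsSelfAdjoint (P k)) (hPn : ∀ k, ‖P k‖ ≤ 1)
    (hσ : ∑' l : d → ℤ, ENNReal.ofReal (sobolevWeight (-2) l ^ 2) < ∞)
    {T : ℝ} (hT : 0 ≤ T)
    -- the seed
    {v : lp (fun _ : (d → ℤ) => V) 2} (hv1 : ‖v‖ = 1) (hvr : RapidDecay (⇑v))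
    (hvfix : ∀ k, P k (v k) = v k) (hvreal : ∀ j k, π j (v (-k)) = conj (π j (v k)))
    (hvdiv : ∀ k, ∑ j, ((k j : ℤ) : ℂ) * π j (v k) = 0)
    {lam ε : ℝ} (hlam : 0 ≤ lam) (hε : 0 < ε)
    -- the Galerkin levels of the seed: existence, linear invariants, the `H²` bound
    {u : ℕ → ℝ → lp (fun _ : (d → ℤ) => V) 2} {r : ℝ} (hr : 0 < r)
    (sol_continuousOn : ∀ n, ContinuousOn (u n) (Icc 0 T))
    (sol_init : ∀ n, u n 0 = cubeProj (n + K) (ε • v))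
    (sol_hasDerivWithinAt : ∀ n, ∀ t ∈ Icc 0 T,
      HasDerivWithinAt (u n) (cubeProj (n + K) (nsField ν Uv π P (u n t))) (Icc 0 T) t)
    (sol_proj : ∀ n, ∀ t ∈ Icc 0 T, cubeProj (n + K) (u n t) = u n t)
    (sol_fix : ∀ n, ∀ t ∈ Icc 0 T, ∀ k, P k ((u n t : (d → ℤ) → V) k) = (u n t : (d → ℤ) → V) k)
    (sol_real : ∀ n, ∀ t ∈ Icc 0 T, ∀ j k,
      π j ((u n t : (d → ℤ) → V) (-k)) = conj (π j ((u n t : (d → ℤ) → V) k)))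
    (sol_div : ∀ n, ∀ t ∈ Icc 0 T, ∀ k, ∑ j, ((k j : ℤ) : ℂ) * π j ((u n t : (d → ℤ) → V) k) = 0)
    (sol_bound : ∀ n, ∀ t ∈ Icc 0 T, ‖u n t‖ ≤ r)
    -- the certificates (verbatim g18)
    {μ : ℝ}
    {G₁ G₂ G : lp (fun _ : (d → ℤ) => V) 2 →L[ℝ] lp (fun _ : (d → ℤ) => V) 2}
    (hG₁ : ∀ x y : lp (fun _ : (d → ℤ) => V) 2, ⟪G₁ x, y⟫_ℂ = ⟪x, G₁ y⟫_ℂ)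
    (hG₂ : ∀ x y : lp (fun _ : (d → ℤ) => V) 2, ⟪G₂ x, y⟫_ℂ = ⟪x, G₂ y⟫_ℂ)
    (hG : ∀ x y : lp (fun _ : (d → ℤ) => V) 2, ⟪G x, y⟫_ℂ = ⟪x, G y⟫_ℂ)
    (hG₁P : ∀ n, ∀ w z : lp (fun _ : (d → ℤ) => V) 2, ⟪G₁ w, cubeProj (n + K) z⟫_ℂ = ⟪G₁ (cubeProj (n + K) w), z⟫_ℂ)
    (hG₂P : ∀ n, ∀ w z : lp (fun _ : (d → ℤ) => V) 2, ⟪G₂ w, cubeProj (n + K) z⟫_ℂ = ⟪G₂ (cubeProj (n + K) w), z⟫_ℂ)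
    (hGP : ∀ n, ∀ w z : lp (fun _ : (d → ℤ) => V) 2, ⟪G w, cubeProj (n + K) z⟫_ℂ = ⟪G (cubeProj (n + K) w), z⟫_ℂ)
    (hG₁pos : ∀ x : lp (fun _ : (d → ℤ) => V) 2, 0 ≤ re ⟪G₁ x, x⟫_ℂ) {ω c m₂ M₁ : ℝ} (hc : 0 < c)
    (hm₂ : 0 < m₂) (hM₁ : 0 ≤ M₁)
    (hm₂' : ∀ x : lp (fun _ : (d → ℤ) => V) 2, m₂ * ‖x‖ ^ 2 ≤ re ⟪G₂ x, x⟫_ℂ)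
    (hM₁' : ∀ x : lp (fun _ : (d → ℤ) => V) 2, re ⟪G₁ x, x⟫_ℂ ≤ M₁ * (eNormSq (-1) (⇑x)).toReal)
    {m M ω₁ : ℝ} (hm0 : 0 < m) (hm : ∀ x : lp (fun _ : (d → ℤ) => V) 2, m * ‖x‖ ^ 2 ≤ re ⟪G x, x⟫_ℂ)
    (hM : ∀ x : lp (fun _ : (d → ℤ) => V) 2, re ⟪G x, x⟫_ℂ ≤ M * ‖x‖ ^ 2)
    (h₁ : ∀ n, ∀ w : lp (fun _ : (d → ℤ) => V) 2,
      2 * re ⟪G₁ (cubeProj (n + K) w), linOp ν Uv π P (cubeProj (n + K) w)⟫_ℂ + c * re ⟪G₂ (cubeProj (n + K) w), cubeProj (n + K) w⟫_ℂ ≤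
        2 * ω * re ⟪G₁ (cubeProj (n + K) w), cubeProj (n + K) w⟫_ℂ)
    (h₂ : ∀ n, ∀ w : lp (fun _ : (d → ℤ) => V) 2,
      re ⟪G₂ (cubeProj (n + K) w), linOp ν Uv π P (cubeProj (n + K) w)⟫_ℂ ≤ ω * re ⟪G₂ (cubeProj (n + K) w), cubeProj (n + K) w⟫_ℂ)
    (hL : ∀ n, ∀ w : lp (fun _ : (d → ℤ) => V) 2,
      re ⟪G (cubeProj (n + K) w), linOp ν Uv π P (cubeProj (n + K) w)⟫_ℂ ≤ ω₁ * re ⟪G (cubeProj (n + K) w), cubeProj (n + K) w⟫_ℂ)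
    (hμ₁ : μ ≤ ω₁) (hμ₂ : μ ≤ ω)
    (htail : ∀ n, ∀ q : lp (fun _ : (d → ℤ) => V) 2, cubeProj (n + K) q = 0 →
      2 * μ * re ⟪G₁ q, q⟫_ℂ + c * re ⟪G₂ q, q⟫_ℂ ≤ 2 * ω * re ⟪G₁ q, q⟫_ℂ)
    (hgap : ω < 2 * lam)
    (hres : Tendsto (fun n => ‖cubeProj (n + K) (linOp ν Uv π P (cubeProj (n + K) v)) - lam • cubeProj (n + K) v‖)
      atTop (𝓝 0))
    {C' : ℝ}
    (hCC' : Real.sqrt (M₁ / (c * m₂)) * (2 * ((Fintype.card d : ℝ) * (2 * Real.pi)) *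
        Real.sqrt ((∑' l : d → ℤ, ENNReal.ofReal (sobolevWeight (-2) l ^ 2)).toReal)) * Real.sqrt (Real.pi / (2 * lam - ω)) < C')
    (hsmall : ∀ t ∈ Icc 0 T, C' * (3 / 2 : ℝ) ^ 2 * (ε * Real.exp (lam * t)) < 3 / 2 - 1)
    -- the true solution, read in the class with a uniform polynomial tail
    {w : ℝ → lp (fun _ : (d → ℤ) => V) 2} (hw : ContinuousOn w (Icc 0 T)) (hw0 : w 0 = ε • v)
    (hw' : ∀ t ∈ Ioo 0 T, HasDerivAt w (nsField ν Uv π P (w t)) t)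
    {Cw : ℝ} (hCw : 0 ≤ Cw)
    (hwdec : ∀ t ∈ Icc 0 T, ∀ k, ‖(w t : (d → ℤ) → V) k‖ ≤ Cw * sobolevWeight (-((Fintype.card d : ℝ) + 3)) k)
    (hwfix : ∀ t ∈ Icc 0 T, ∀ k, P k ((w t : (d → ℤ) → V) k) = (w t : (d → ℤ) → V) k)
    (hwreal : ∀ t ∈ Icc 0 T, ∀ j k, π j ((w t : (d → ℤ) → V) (-k)) = conj (π j ((w t : (d → ℤ) → V) k)))
    (hwdiv : ∀ t ∈ Icc 0 T, ∀ k, ∑ j, ((k j : ℤ) : ℂ) * π j ((w t : (d → ℤ) → V) k) = 0)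
    {t : ℝ} (ht : t ∈ Icc 0 T) (hχ : ε * Real.exp (lam * t) ≤ 2 / (9 * C')) :
    ε * Real.exp (lam * t) / 2 ≤ ‖w t‖ := by
  -- the seed `ε • v`: rapidly decreasing, constrained, under a polynomial floor
  set z : lp (fun _ : (d → ℤ) => V) 2 := ε • v with hz
  have hzr : RapidDecay (⇑z) := rapidDecay_coe_smul hvr ε
  set sd : ℝ := (Fintype.card d : ℝ) + 3 with hsd
  have hzfin : eNormSq sd (⇑z) < ∞ := eNormSq_lt_top_of_rapidDecay hzr _
  set Cv : ℝ := Real.sqrt (eNormSq sd (⇑z)).toReal with hCv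
  have hCv0 : 0 ≤ Cv := Real.sqrt_nonneg _
  have hzdec : ∀ k, ‖(z : (d → ℤ) → V) k‖ ≤ Cv * sobolevWeight (-sd) k := fun k =>
    norm_apply_le_of_eNormSq_le hzfin le_rfl k
  -- initial energies of the levels are dominated by those of the seed
  set E₃ : ℝ := (eNormSq 3 (wmul (-2) ⇑z)).toReal with hE₃
  set Eσ : ℝ := (eNormSq ((Fintype.card d + 5 : ℕ) : ℝ) (wmul (-2) ⇑z)).toReal with hEσ
  have hzr' : RapidDecay (wmul (-2) (⇑z)) := rapidDecay_wmul hzr (-2)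
  have h3 : ∀ n, (eNormSq 3 (wmul (-2) ⇑(u n 0))).toReal ≤ E₃ := fun n => by
    rw [sol_init n, hE₃]
    exact ENNReal.toReal_mono (eNormSq_lt_top_of_rapidDecay hzr' _).ne (eNormSq_unscale_cubeProj_le _ _ _)
  have hσ0 : ∀ n, (eNormSq ((Fintype.card d + 5 : ℕ) : ℝ) (wmul (-2) ⇑(u n 0))).toReal ≤ Eσ := fun n => by
    rw [sol_init n, hEσ]
    exact ENNReal.toReal_mono (eNormSq_lt_top_of_rapidDecay hzr' _).ne (eNormSq_unscale_cubeProj_le _ _ _)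
  -- the levels lie in the coarse box of radius `r` (linear clauses + the `H²` bound)
  have hWr : ∀ n, ∀ t ∈ Icc 0 T, u n t ∈ box (fun _ => r) π P := fun n t ht =>
    mem_box.2 ⟨fun k => (norm_apply_le (u n t) k).trans (sol_bound n t ht), sol_fix n t ht,
      sol_real n t ht, sol_div n t ht⟩
  -- right derivatives on `[0, T)`
  have hderiv : ∀ n, ∀ t ∈ Ico 0 T,
      HasDerivWithinAt (u n) (cubeProj (n + K) (nsField ν Uv π P (u n t))) (Ici t) t := by
    intro n t ht
    refine (sol_hasDerivWithinAt n t (Ico_subset_Icc_self ht)).mono_of_mem_nhdsWithin ?_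
    exact Set.ordConnected_Icc.mem_nhdsGE (Ico_subset_Icc_self ht) (right_mem_Icc.2 (ht.1.trans ht.2.le)) ht.2
  -- ONE box for all levels, with floor `C₀ = Cv + Cw`
  obtain ⟨ρ, hρ0, hρ1, hρ2, hfloor, hmem⟩ := exists_residence_box (ι := ℕ) (N := fun n => n + K)
    (y := u) (C₀ := Cv + Cw) hν hUv hπ hUreal hUdiv hPsa hPn hσ hr ENNReal.toReal_nonneg
    ENNReal.toReal_nonneg (add_nonneg hCv0 hCw) sol_continuousOn hderiv sol_proj hWr sol_bound h3 hσ0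
  -- the seed and the true solution fit under the floor
  have hzW : z ∈ box ρ π P := by
    rw [hz]
    refine smul_mem_box hvfix hvreal hvdiv fun k => ?_
    have h := hzdec k
    rw [hz, coe_real_smul_apply, norm_smul, Complex.norm_real, Real.norm_eq_abs] at h
    refine h.trans ((mul_le_mul_of_nonneg_right (le_add_of_nonneg_right hCw)
      (sobolevWeight_pos _ _).le).trans (hfloor k))
  have hwW : ∀ t ∈ Icc 0 T, w t ∈ box ρ π P := fun t ht =>
    mem_box.2 ⟨fun k => (hwdec t ht k).trans ((mul_le_mul_of_nonneg_right
      (le_add_of_nonneg_left hCv0) (sobolevWeight_pos _ _).le).trans (hfloor k)),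
      hwfix t ht, hwreal t ht, hwdiv t ht⟩
  -- g18's theorem with `Z = {ε • v}`, `W = box ρ π P`
  refine half_prediction_nsField_shift K hν.le hUv hUreal hUdiv hπ hPsa hPn hρ0 hρ1 hρ2
    (Z := {z}) (u := fun n _ => u n) hT (Set.singleton_subset_iff.2 hzW)
    (fun n x hx => sol_continuousOn n) (fun n x hx => by rw [Set.mem_singleton_iff.1 hx]; exact sol_init n)
    (fun n x hx t ht => (sol_hasDerivWithinAt n t (Ioo_subset_Icc_self ht)).hasDerivAt
      (Icc_mem_nhds ht.1 ht.2))
    (fun n x hx t ht => hmem n t ht) (fun n x hx => sol_proj n) hσ hG₁ hG₂ hG hG₁P hG₂P hGP hG₁pos hc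
    hm₂ hM₁ hm₂' hM₁' hm0 hm hM h₁ h₂ hL hμ₁ hμ₂ htail hv1 hgap hlam hε (Set.mem_singleton z) hres hCC'
    hsmall hw hw0 hw' hwW ht hχ

end Keep


end Summit.NavierStokesRegularity.FluidComputer.TransportGalerkinEmergenceH2

end
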